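import Mathlib
import Summits.Ventures.PercRepro2.SwOutMixedArmsBaseHull
import Summits.Ventures.PercRepro2.SwOutMixedArmsBaseDual

/-!
# The vertex set of the classes assigned `false` (blind cell PercRepro2, night-4 g22,
2026-08-27; proofs/NIGHT4-G22.md §3)

`falseSetR q`: the vertices of the u-arms, pieces, dropped vertices and far arms whose coordinate
is `false` at a point `q` of the raw cube (`mem_falseSetR_iff`, `falseSetR_subset`), and the
coordinates of the flipped point (`flipPt_fst`, `flipPt_a`, `flipPt_uP`, `flipPt_f`).
-/

namespace Summit.Ventures.PercRepro2

namespace MixedArms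

open Hull LocRows BigBlock

variable {V : Type*} {E : Type*} [Fintype E] [DecidableEq E]

open scoped Classical

variable {ι ρ ν κ : Type*} {ends : E → Sym2 V} {σ : Config E} {h u : V} {U : ι → Set V}
  {p : ρ → V} {Ah : ν → Set V} {arm : ν → ρ} {F : κ → Set V}

section FalseSet

variable (U p Ah F)

/-- The vertices of the classes assigned `false` by a point. -/
def falseSetR (q : PtR ι ρ ν κ) : Set V :=
  {x | ∃ j, q.1 j = false ∧ x ∈ U j} ∪ {x | ∃ i, q.2.1 i = false ∧ x ∈ Ah i} ∪
    {x | ∃ r, x = p r ∧ q.2.2.1 r = false} ∪ {x | ∃ k, q.2.2.2.2 k = false ∧ x ∈ F k}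

end FalseSet

section Generic

omit [Fintype E] [DecidableEq E] in
/-- The u-arm coordinate of the flipped point. -/
lemma flipPt_fst (q : PtR ι ρ ν κ) (j : ι) : (flipPt q).1 j = !q.1 j := rfl

omit [Fintype E] [DecidableEq E] in
/-- The piece coordinate of the flipped point. -/
lemma flipPt_a (q : PtR ι ρ ν κ) (i : ν) : (flipPt q).2.1 i = !q.2.1 i := rfl

omit [Fintype E] [DecidableEq E] in
/-- The attachment coordinate of the flipped point. -/
lemma flipPt_uP (q : PtR ι ρ ν κ) (r : ρ) : (flipPt q).2.2.1 r = !q.2.2.1 r := rfl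

omit [Fintype E] [DecidableEq E] in
/-- The far-arm coordinate of the flipped point. -/
lemma flipPt_f (q : PtR ι ρ ν κ) (k : κ) : (flipPt q).2.2.2.2 k = !q.2.2.2.2 k := rfl

omit [Fintype E] [DecidableEq E] in
/-- Membership in `falseSetR`. -/
lemma mem_falseSetR_iff {q : PtR ι ρ ν κ} {x : V} :
    x ∈ falseSetR U p Ah F q ↔ (∃ j, q.1 j = false ∧ x ∈ U j) ∨ (∃ i, q.2.1 i = false ∧ x ∈ Ah i) ∨
      (∃ r, x = p r ∧ q.2.2.1 r = false) ∨ ∃ k, q.2.2.2.2 k = false ∧ x ∈ F k := by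
  simp only [falseSetR, Set.mem_union, Set.mem_setOf_eq, or_assoc]

omit [Fintype E] [DecidableEq E] in
/-- `falseSetR` lies in the dropped vertices and the arms. -/
lemma falseSetR_subset {q : PtR ι ρ ν κ} {x : V} (hx : x ∈ falseSetR U p Ah F q) :
    x ∈ Set.range p ∪ armsAllR U Ah F := by
  rw [mem_falseSetR_iff] at hx
  rcases hx with ⟨j, -, hx⟩ | ⟨i, -, hx⟩ | ⟨r, rfl, -⟩ | ⟨k, -, hx⟩
  · exact Or.inr (Or.inl (Or.inl (Set.mem_iUnion.2 ⟨j, hx⟩)))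
  · exact Or.inr (Or.inl (Or.inr (Set.mem_iUnion.2 ⟨i, hx⟩)))
  · exact Or.inl ⟨r, rfl⟩
  · exact Or.inr (Or.inr (Set.mem_iUnion.2 ⟨k, hx⟩))

end Generic

end MixedArms

end Summit.Ventures.PercRepro2
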